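import Summits.PneNP.PneNP.Theorems.ConstantBand.Negative.LoadBearing
import Literature.Computability.Complexity.RossmanMonotoneCliqueGraphs
import Literature.Computability.Complexity.CliqueThresholdBounds

/-!
# Near-clique contiguity on a critical slice (S2 of the line `flat-prior-relative-minterms`), part 5: window

Window bookkeeping for central `j` (`T - T^{3/4} - 1 - w ≤ i ≤ T + T^{3/4} + w`, `T = C(n,2)·n^{-2/(k-1)} → ∞`)
and the asymptotics of the three second-moment error terms (diagonal `→ 0`, far-pair ratio `→ 1`,
near pairs `→ 0` by the exponent gap `n^{-a(k-a)/(k-1)}`). [folklore]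
-/

noncomputable section
namespace Summit.PneNP.PneNP.Cruxes.ConstantBand.FlatPriorRelativeMinterms

set_option linter.dupNamespace false

open Literature.Computability.Complexity Filter Classical
open Finset hiding slice
open Summit.PneNP.PneNP.Theorems.ConstantBand.Negative
open scoped Topology

section Window

set_option quotPrecheck false

variable {n : ℕ}

/-- The `k`-subsets of the vertex set. -/
local notation "𝒜⟦" n ", " k "⟧" => powersetCard k (univ : Finset (Fin n))

/-- The admissible pairs `(A, e)`: a `k`-set `A` and an edge `e` of `K_A`. -/
local notation "𝒫⟦" n ", " k "⟧" =>
  Finset.filter (fun ae : Finset (Fin n) × Edge n => ae.2 ∈ edgesIn ae.1)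
    ((powersetCard k (univ : Finset (Fin n))) ×ˢ (univ : Finset (Edge n)))

/-- The pattern of `(A, e)` in `y`: `K_A − e ⊆ on(y)` and `e ∉ on(y)`. -/
local notation "Pat⟦" A ", " e ", " y "⟧" =>
  ((∀ e' ∈ edgesIn A, e' ≠ e → y e' = true) ∧ y e = false)

/-- The near-clique count `X(y) = #{(A,e) : K_A − e ⊆ on(y), e ∉ on(y)}`. -/
local notation "Xc⟦" n ", " k ", " y "⟧" =>
  Finset.card (Finset.filter (fun ae : Finset (Fin n) × Edge n => Pat⟦ae.1, ae.2, y⟧) 𝒫⟦n, k⟧)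

/-- The threshold density `θ_k(n) = n^{-2/(k-1)}`. -/
local notation "θ⟦" k ", " n "⟧" => ((n : ℝ) ^ (-(2 : ℝ) / ((k : ℝ) - 1)))

/-- The real threshold `T_k(n) = C(n,2)·θ_k(n)` (`thr k n = ⌊T_k(n)⌋₊`). -/
local notation "T⟦" k ", " n "⟧" => (((Nat.choose n 2 : ℕ) : ℝ) * θ⟦k, n⟧)

/-! ### Window bookkeeping and asymptotics -/

/-- Upper window: for central `j` and `i ≤ j + w`, `i ≤ T + T^{3/4} + w`. [folklore] -/
theorem ncc_window_up {k w n j i : ℕ} (hj : Central k n j) (hi : i ≤ j + w) :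
    (i : ℝ) ≤ T⟦k, n⟧ + T⟦k, n⟧ ^ ((3 : ℝ) / 4) + w := by
  -- adapted from Cruxes/ConstantBand/Disproof.lean §4 (`le_T_mul_bfac`)
  have hT0 : 0 ≤ T⟦k, n⟧ := mul_nonneg (Nat.cast_nonneg _) (Real.rpow_nonneg (Nat.cast_nonneg _) _)
  have hfl : (thr k n : ℝ) ≤ T⟦k, n⟧ := Nat.floor_le hT0
  have hfl' : (thr k n : ℝ) ^ ((3 : ℝ) / 4) ≤ T⟦k, n⟧ ^ ((3 : ℝ) / 4) :=
    Real.rpow_le_rpow (Nat.cast_nonneg _) hfl (by norm_num)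
  have hj' : (j : ℝ) ≤ thr k n + (thr k n : ℝ) ^ ((3 : ℝ) / 4) := by
    have := (abs_sub_le_iff.1 hj).1
    linarith
  have hi' : (i : ℝ) ≤ j + w := by exact_mod_cast hi
  linarith

/-- Lower window: for central `j` and `j ≤ i + w`, `T - T^{3/4} - 1 - w ≤ i`. [folklore] -/
theorem ncc_window_lo {k w n j i : ℕ} (hj : Central k n j) (hi : j ≤ i + w) :
    T⟦k, n⟧ - T⟦k, n⟧ ^ ((3 : ℝ) / 4) - 1 - w ≤ i := by
  have hT0 : 0 ≤ T⟦k, n⟧ := mul_nonneg (Nat.cast_nonneg _) (Real.rpow_nonneg (Nat.cast_nonneg _) _)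
  have hfl : (thr k n : ℝ) ≤ T⟦k, n⟧ := Nat.floor_le hT0
  have hlt : T⟦k, n⟧ < thr k n + 1 := Nat.lt_floor_add_one _
  have hfl' : (thr k n : ℝ) ^ ((3 : ℝ) / 4) ≤ T⟦k, n⟧ ^ ((3 : ℝ) / 4) :=
    Real.rpow_le_rpow (Nat.cast_nonneg _) hfl (by norm_num)
  have hj' : (thr k n : ℝ) - (thr k n : ℝ) ^ ((3 : ℝ) / 4) ≤ j := by
    have := (abs_sub_le_iff.1 hj).2
    linarith
  have hi' : (j : ℝ) ≤ i + w := by exact_mod_cast hi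
  linarith

/-- `T_k(n) ≥ (n - 1)/2` for `k ≥ 3`. [folklore] -/
theorem ncc_T_ge {k n : ℕ} (hk : 3 ≤ k) (hn : 1 ≤ n) : ((n : ℝ) - 1) / 2 ≤ T⟦k, n⟧ := by
  -- adapted from Cruxes/ConstantBand/Disproof.lean §4 (`T_ge`)
  have hn1 : (1 : ℝ) ≤ n := by exact_mod_cast hn
  have hk' : (3 : ℝ) ≤ k := by exact_mod_cast hk
  have hθ : (n : ℝ) ^ (-(1 : ℝ)) ≤ θ⟦k, n⟧ := by
    apply Real.rpow_le_rpow_of_exponent_le hn1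
    rw [neg_div, neg_le_neg_iff, div_le_one (by linarith)]
    linarith
  calc ((n : ℝ) - 1) / 2 = (n.choose 2 : ℝ) * (n : ℝ) ^ (-(1 : ℝ)) := by
        rw [Nat.cast_choose_two, Real.rpow_neg_one]
        field_simp
    _ ≤ T⟦k, n⟧ := mul_le_mul_of_nonneg_left hθ (Nat.cast_nonneg _)

/-- `T_k(n) → ∞`. [folklore] -/
theorem ncc_tendsto_T {k : ℕ} (hk : 3 ≤ k) : Tendsto (fun n : ℕ => T⟦k, n⟧) atTop atTop := by
  -- adapted from Cruxes/ConstantBand/Disproof.lean §4 (`tendsto_T`)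
  have h1 : Tendsto (fun n : ℕ => ((n : ℝ) - 1) / 2) atTop atTop := by
    refine Tendsto.atTop_div_const (by norm_num) ?_
    simpa [sub_eq_add_neg] using tendsto_atTop_add_const_right atTop (-1 : ℝ) tendsto_natCast_atTop_atTop
  refine tendsto_atTop_mono' atTop ?_ h1
  filter_upwards [eventually_ge_atTop 1] with n hn
  exact ncc_T_ge hk hn

/-- **The window opens**: eventually `T^{3/4} + c ≤ T/2`. [folklore] -/
theorem ncc_eventually_window {k : ℕ} (hk : 3 ≤ k) (c : ℝ) :
    ∀ᶠ n : ℕ in atTop, T⟦k, n⟧ ^ ((3 : ℝ) / 4) + c ≤ T⟦k, n⟧ / 2 := by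
  have hT := ncc_tendsto_T hk
  have h1 : Tendsto (fun n : ℕ => T⟦k, n⟧ ^ (-(1 / 4 : ℝ))) atTop (𝓝 0) :=
    (tendsto_rpow_neg_atTop (by norm_num : (0 : ℝ) < 1 / 4)).comp hT
  have h2 : ∀ᶠ n : ℕ in atTop, T⟦k, n⟧ ^ (-(1 / 4 : ℝ)) < 1 / 4 :=
    (tendsto_order.1 h1).2 _ (by norm_num)
  filter_upwards [h2, hT.eventually_ge_atTop (4 * c), hT.eventually_ge_atTop 1] with n hq hc h1'
  have hTpos : 0 < T⟦k, n⟧ := by linarith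
  have hexp : T⟦k, n⟧ ^ ((3 : ℝ) / 4) = T⟦k, n⟧ * T⟦k, n⟧ ^ (-(1 / 4 : ℝ)) := by
    conv_rhs => rw [show T⟦k, n⟧ * T⟦k, n⟧ ^ (-(1 / 4 : ℝ)) =
      T⟦k, n⟧ ^ (1 : ℝ) * T⟦k, n⟧ ^ (-(1 / 4 : ℝ)) by rw [Real.rpow_one]]
    rw [← Real.rpow_add hTpos]
    norm_num
  rw [hexp]
  nlinarith

/-- **Registered sub-goal of the Window file** (the central window opens, `∀`-form of
`ncc_eventually_window`, notation expanded). [folklore] -/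
theorem ncc_window_pkg :
    ∀ k : ℕ, 3 ≤ k → ∀ c : ℝ, ∀ᶠ n : ℕ in atTop,
      (((n.choose 2 : ℕ) : ℝ) * (n : ℝ) ^ (-(2 : ℝ) / ((k : ℝ) - 1))) ^ ((3 : ℝ) / 4) + c ≤
        ((n.choose 2 : ℕ) : ℝ) * (n : ℝ) ^ (-(2 : ℝ) / ((k : ℝ) - 1)) / 2 :=
  fun _ hk c => ncc_eventually_window hk c

/-- `θ_k(n) → 0`, in the eventual form `θ ≤ η`. [folklore] -/
theorem ncc_eventually_θ_le {k : ℕ} (hk : 3 ≤ k) {η : ℝ} (hη : 0 < η) :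
    ∀ᶠ n : ℕ in atTop, θ⟦k, n⟧ ≤ η :=
  ((tendsto_order.1 (tendsto_rpow_threshold (k := k) (by omega))).2 η hη).mono fun _ h => h.le

/-- **The diagonal term vanishes**: eventually `2/(C(n,k)·K·(θ/2)^{K-1}) ≤ η`
(`C(n,k)(θ/2)^K ≥ 2^{-K}/(2^k k!)` and `θ → 0`). [folklore] -/
theorem ncc_eventually_E1 {k : ℕ} (hk : 3 ≤ k) {η : ℝ} (hη : 0 < η) :
    ∀ᶠ n : ℕ in atTop, 2 / ((n.choose k : ℝ) * k.choose 2 * (θ⟦k, n⟧ / 2) ^ (k.choose 2 - 1)) ≤ η := by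
  set K := k.choose 2 with hKq
  have hK1 : 1 ≤ K := by
    rw [hKq]
    exact le_trans (by decide : 1 ≤ Nat.choose 3 2) (Nat.choose_le_choose 2 hk)
  set c₀ : ℝ := (1 / 2 : ℝ) ^ K / (2 ^ k * k.factorial) with hc₀
  have hc₀pos : 0 < c₀ := by positivity
  have hKR : (1 : ℝ) ≤ K := by exact_mod_cast hK1
  filter_upwards [eventually_ge_atTop (2 * k), ncc_eventually_θ_le hk (show 0 < η * K * c₀ by positivity)]
    with n hn hθ
  have hn1 : 1 ≤ n := by omega
  have hθpos : 0 < θ⟦k, n⟧ := Real.rpow_pos_of_pos (by exact_mod_cast hn1) _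
  have hC : (0 : ℝ) < n.choose k := by exact_mod_cast Nat.choose_pos (by omega)
  have hlow : c₀ ≤ (n.choose k : ℝ) * (θ⟦k, n⟧ / 2) ^ K := by
    have := le_choose_mul_threshold_pow (k := k) (n := n) (by omega) hn (a := 1 / 2) (by norm_num)
    rw [hc₀]
    convert this using 2
    ring
  have hsplit : (θ⟦k, n⟧ / 2) ^ K = (θ⟦k, n⟧ / 2) ^ (K - 1) * (θ⟦k, n⟧ / 2) := by
    rw [← pow_succ]
    congr 1
    omega
  rw [div_le_iff₀ (by positivity)]
  rw [hsplit] at hlow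
  -- `c₀ ≤ C (θ/2)^{K-1} θ/2` and `θ ≤ η K c₀`
  have h1 : c₀ * 2 ≤ (n.choose k : ℝ) * (θ⟦k, n⟧ / 2) ^ (K - 1) * θ⟦k, n⟧ := by nlinarith
  have h2 : (n.choose k : ℝ) * (θ⟦k, n⟧ / 2) ^ (K - 1) * θ⟦k, n⟧ ≤
      (n.choose k : ℝ) * (θ⟦k, n⟧ / 2) ^ (K - 1) * (η * K * c₀) :=
    mul_le_mul_of_nonneg_left hθ (by positivity)
  nlinarith [h1, h2, hc₀pos]

/-- **The far-pair ratio tends to one**: eventually `(N/(N+1-2K))^K ≤ 1 + η`. [folklore] -/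
theorem ncc_eventually_ratio {k : ℕ} (hk : 3 ≤ k) {η : ℝ} (hη : 0 < η) :
    ∀ᶠ n : ℕ in atTop,
      ((n.choose 2 : ℝ) / (n.choose 2 + 1 - 2 * k.choose 2)) ^ k.choose 2 ≤ 1 + η := by
  set K := k.choose 2 with hKq
  -- `N → ∞`
  have hN : Tendsto (fun n : ℕ => (n.choose 2 : ℝ)) atTop atTop := by
    refine tendsto_atTop_mono' atTop ?_ (ncc_tendsto_T hk)
    filter_upwards [eventually_ge_atTop 1] with n hn
    have hθ1 : θ⟦k, n⟧ ≤ 1 := by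
      apply Real.rpow_le_one_of_one_le_of_nonpos (by exact_mod_cast hn)
      have hk' : (3 : ℝ) ≤ k := by exact_mod_cast hk
      rw [neg_div]
      exact neg_nonpos.2 (div_nonneg (by norm_num) (by linarith))
    calc T⟦k, n⟧ ≤ (n.choose 2 : ℝ) * 1 := mul_le_mul_of_nonneg_left hθ1 (Nat.cast_nonneg _)
      _ = _ := mul_one _
  have hD : Tendsto (fun n : ℕ => (n.choose 2 : ℝ) + 1 - 2 * K) atTop atTop := by
    have := tendsto_atTop_add_const_right atTop (1 - 2 * (K : ℝ)) hN
    refine this.congr fun n => ?_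
    ring
  have hfrac : Tendsto (fun n : ℕ => (2 * (K : ℝ) - 1) / ((n.choose 2 : ℝ) + 1 - 2 * K)) atTop (𝓝 0) :=
    tendsto_const_nhds.div_atTop hD
  have hlim : Tendsto (fun n : ℕ => (1 + (2 * (K : ℝ) - 1) / ((n.choose 2 : ℝ) + 1 - 2 * K)) ^ K)
      atTop (𝓝 1) := by
    have := ((tendsto_const_nhds (x := (1 : ℝ))).add hfrac).pow K
    simpa using this
  have hev : ∀ᶠ n : ℕ in atTop,
      (1 + (2 * (K : ℝ) - 1) / ((n.choose 2 : ℝ) + 1 - 2 * K)) ^ K < 1 + η :=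
    (tendsto_order.1 hlim).2 _ (by linarith)
  filter_upwards [hev, hD.eventually_gt_atTop 0] with n hn hpos
  have heq : (n.choose 2 : ℝ) / (n.choose 2 + 1 - 2 * K) = 1 + (2 * (K : ℝ) - 1) / ((n.choose 2 : ℝ) + 1 - 2 * K) := by
    field_simp
    ring
  rw [heq]
  exact hn.le


/-- **The near-pair terms vanish**: eventually
`4·Σ_{a=2}^{k-1} C(k,a)·C(n-k,k-a)·(2θ)^{2K-C(a,2)-2}/(C(n,k)·(θ/2)^{2K-2}) ≤ η` — each term is
`O(n^{k-a}·θ^{K-C(a,2)}) = O(n^{-a(k-a)/(k-1)})`, the exponent gap of the strictly balanced `K_k`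
(cf. Rossman 2010, App. B, proof of Lemma 23 (a)). [folklore] -/
theorem ncc_eventually_E3 {k : ℕ} (hk : 3 ≤ k) {η : ℝ} (hη : 0 < η) :
    ∀ᶠ n : ℕ in atTop,
      4 * (∑ a ∈ Ico 2 k, (k.choose a : ℝ) * (n - k).choose (k - a) *
          (2 * θ⟦k, n⟧) ^ (2 * k.choose 2 - a.choose 2 - 2)) /
        ((n.choose k : ℝ) * (θ⟦k, n⟧ / 2) ^ (2 * k.choose 2 - 2)) ≤ η := by
  have hK3 : 3 ≤ k.choose 2 := (Nat.choose_le_choose 2 hk : Nat.choose 3 2 ≤ k.choose 2)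
  have hk1 : (1 : ℝ) < k := by exact_mod_cast (show 1 < k by omega)
  -- the comparison terms `g_a(n) = C(k,a)·C(n-k,k-a)·θ^{K-C(a,2)}` tend to zero
  have hg : ∀ a ∈ Ico 2 k, Tendsto (fun n : ℕ => (k.choose a : ℝ) * (n - k).choose (k - a) *
      θ⟦k, n⟧ ^ (k.choose 2 - a.choose 2)) atTop (𝓝 0) := by
    -- adapted from RossmanMonotoneCliqueLemma23Proofs (`Rossman2010_plantedVsConditioned_holds`)
    intro a ha
    rw [mem_Ico] at ha
    have haK : a.choose 2 ≤ k.choose 2 := Nat.choose_le_choose 2 ha.2.le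
    have hk1' : (k : ℝ) - 1 ≠ 0 := (sub_pos.2 hk1).ne'
    have hexp : ((k - a : ℕ) : ℝ) + -(2 : ℝ) / ((k : ℝ) - 1) * ((k.choose 2 - a.choose 2 : ℕ) : ℝ) =
        -((a : ℝ) * ((k : ℝ) - a) / ((k : ℝ) - 1)) := by
      rw [Nat.cast_sub haK, Nat.cast_choose_two, Nat.cast_choose_two, Nat.cast_sub ha.2.le]
      field_simp
      ring
    have ha2 : (2 : ℝ) ≤ a := by exact_mod_cast ha.1
    have hak : (a : ℝ) < k := by exact_mod_cast ha.2
    have hneg : 0 < (a : ℝ) * ((k : ℝ) - a) / ((k : ℝ) - 1) :=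
      div_pos (mul_pos (by linarith) (by linarith)) (by linarith)
    have hlim : Tendsto (fun n : ℕ => (n : ℝ) ^ (-((a : ℝ) * ((k : ℝ) - a) / ((k : ℝ) - 1))))
        atTop (𝓝 0) :=
      (tendsto_rpow_neg_atTop hneg).comp tendsto_natCast_atTop_atTop
    have hlim' := hlim.const_mul (k.choose a : ℝ)
    rw [mul_zero] at hlim'
    refine squeeze_zero' (Eventually.of_forall fun n => ?_) ?_ hlim'
    · exact mul_nonneg (mul_nonneg (Nat.cast_nonneg _) (Nat.cast_nonneg _))
        (pow_nonneg (Real.rpow_nonneg (Nat.cast_nonneg _) _) _)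
    filter_upwards [eventually_ge_atTop 1] with n hn1
    have hn0 : (0 : ℝ) < n := by exact_mod_cast hn1
    have h1 : ((n - k).choose (k - a) : ℝ) ≤ (n : ℝ) ^ ((k - a : ℕ) : ℝ) := by
      rw [Real.rpow_natCast]
      exact_mod_cast (Nat.choose_le_pow _ _).trans (Nat.pow_le_pow_left (Nat.sub_le n k) _)
    have hθ0 : 0 ≤ θ⟦k, n⟧ := Real.rpow_nonneg hn0.le _
    calc (k.choose a : ℝ) * (n - k).choose (k - a) * θ⟦k, n⟧ ^ (k.choose 2 - a.choose 2)
        ≤ (k.choose a : ℝ) * (n : ℝ) ^ ((k - a : ℕ) : ℝ) * θ⟦k, n⟧ ^ (k.choose 2 - a.choose 2) := by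
          gcongr
      _ = (k.choose a : ℝ) * (n : ℝ) ^ (-((a : ℝ) * ((k : ℝ) - a) / ((k : ℝ) - 1))) := by
          rw [← Real.rpow_mul_natCast hn0.le, ← hexp, Real.rpow_add hn0]
          ring
  have hsum : Tendsto (fun n : ℕ => ∑ a ∈ Ico 2 k, (k.choose a : ℝ) * (n - k).choose (k - a) *
      θ⟦k, n⟧ ^ (k.choose 2 - a.choose 2)) atTop (𝓝 0) := by
    have := tendsto_finsetSum (Ico 2 k) hg
    simpa using this
  set κ : ℝ := 4 * ((2 : ℝ) ^ (2 * k.choose 2) * 2 ^ (2 * k.choose 2)) * (2 ^ k * k.factorial) with hκ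
  have hκpos : 0 < κ := by positivity
  have hev := (tendsto_order.1 (hsum.const_mul κ)).2 η (by rw [mul_zero]; exact hη)
  filter_upwards [hev, eventually_ge_atTop (2 * k)] with n hn h2k
  have hn1 : 1 ≤ n := by omega
  have hθpos : 0 < θ⟦k, n⟧ := Real.rpow_pos_of_pos (by exact_mod_cast hn1) _
  have hC : (0 : ℝ) < n.choose k := by exact_mod_cast Nat.choose_pos (by omega)
  -- `1 ≤ 2^k k! · C(n,k) θ^K`
  have hlow : 1 ≤ (2 : ℝ) ^ k * k.factorial * ((n.choose k : ℝ) * θ⟦k, n⟧ ^ k.choose 2) := by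
    have h := le_choose_mul_threshold_pow (k := k) (n := n) (by omega) h2k (a := 1) zero_le_one
    rw [one_mul, one_pow] at h
    have h2 : (0 : ℝ) < 2 ^ k * k.factorial := by positivity
    calc (1 : ℝ) = 2 ^ k * k.factorial * (1 / (2 ^ k * k.factorial)) := by field_simp
      _ ≤ _ := mul_le_mul_of_nonneg_left h h2.le
  have hD : (0 : ℝ) < (n.choose k : ℝ) * (θ⟦k, n⟧ / 2) ^ (2 * k.choose 2 - 2) := by positivity
  refine le_trans ?_ hn.le
  rw [div_le_iff₀ hD, mul_sum, mul_sum, sum_mul]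
  refine sum_le_sum fun a ha => ?_
  rw [mem_Ico] at ha
  have haK : a.choose 2 ≤ k.choose 2 := Nat.choose_le_choose 2 ha.2.le
  have hma : 2 * k.choose 2 - a.choose 2 - 2 ≤ 2 * k.choose 2 := by omega
  have hsplit : θ⟦k, n⟧ ^ k.choose 2 * θ⟦k, n⟧ ^ (2 * k.choose 2 - a.choose 2 - 2) =
      θ⟦k, n⟧ ^ (k.choose 2 - a.choose 2) * θ⟦k, n⟧ ^ (2 * k.choose 2 - 2) := by
    rw [← pow_add, ← pow_add]
    congr 1
    omega
  have h22 : (0 : ℝ) < 2 ^ (2 * k.choose 2 - 2) := by positivity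
  -- the key comparison, after clearing the denominator `2^{2K-2}`
  have key : 4 * (2 * θ⟦k, n⟧) ^ (2 * k.choose 2 - a.choose 2 - 2) * 2 ^ (2 * k.choose 2 - 2) ≤
      κ * θ⟦k, n⟧ ^ (k.choose 2 - a.choose 2) * ((n.choose k : ℝ) * θ⟦k, n⟧ ^ (2 * k.choose 2 - 2)) := by
    calc 4 * (2 * θ⟦k, n⟧) ^ (2 * k.choose 2 - a.choose 2 - 2) * 2 ^ (2 * k.choose 2 - 2)
        = 4 * ((2 : ℝ) ^ (2 * k.choose 2 - a.choose 2 - 2) * 2 ^ (2 * k.choose 2 - 2)) *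
            θ⟦k, n⟧ ^ (2 * k.choose 2 - a.choose 2 - 2) := by rw [mul_pow]; ring
      _ ≤ 4 * ((2 : ℝ) ^ (2 * k.choose 2) * 2 ^ (2 * k.choose 2)) *
            θ⟦k, n⟧ ^ (2 * k.choose 2 - a.choose 2 - 2) :=
          mul_le_mul_of_nonneg_right (mul_le_mul_of_nonneg_left (mul_le_mul
            (pow_le_pow_right₀ (by norm_num) hma) (pow_le_pow_right₀ (by norm_num) (by omega))
            (by positivity) (by positivity)) (by norm_num)) (by positivity)
      _ = 4 * ((2 : ℝ) ^ (2 * k.choose 2) * 2 ^ (2 * k.choose 2)) * 1 *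
            θ⟦k, n⟧ ^ (2 * k.choose 2 - a.choose 2 - 2) := by ring
      _ ≤ 4 * ((2 : ℝ) ^ (2 * k.choose 2) * 2 ^ (2 * k.choose 2)) *
            ((2 : ℝ) ^ k * k.factorial * ((n.choose k : ℝ) * θ⟦k, n⟧ ^ k.choose 2)) *
            θ⟦k, n⟧ ^ (2 * k.choose 2 - a.choose 2 - 2) := by gcongr
      _ = κ * (n.choose k : ℝ) * (θ⟦k, n⟧ ^ k.choose 2 * θ⟦k, n⟧ ^ (2 * k.choose 2 - a.choose 2 - 2)) := by
          rw [hκ]; ring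
      _ = _ := by rw [hsplit]; ring
  have hG : (0 : ℝ) ≤ (k.choose a : ℝ) * (n - k).choose (k - a) := by positivity
  calc 4 * ((k.choose a : ℝ) * (n - k).choose (k - a) * (2 * θ⟦k, n⟧) ^ (2 * k.choose 2 - a.choose 2 - 2))
      = (4 * (2 * θ⟦k, n⟧) ^ (2 * k.choose 2 - a.choose 2 - 2) * 2 ^ (2 * k.choose 2 - 2)) *
          ((k.choose a : ℝ) * (n - k).choose (k - a)) / 2 ^ (2 * k.choose 2 - 2) := by
        field_simp
    _ ≤ (κ * θ⟦k, n⟧ ^ (k.choose 2 - a.choose 2) * ((n.choose k : ℝ) * θ⟦k, n⟧ ^ (2 * k.choose 2 - 2))) *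
          ((k.choose a : ℝ) * (n - k).choose (k - a)) / 2 ^ (2 * k.choose 2 - 2) := by gcongr
    _ = _ := by rw [div_pow]; field_simp

end Window

end Summit.PneNP.PneNP.Cruxes.ConstantBand.FlatPriorRelativeMinterms

end
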